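import Summits.Ventures.GridStability.Models.InverterNetworkDamping
import Summits.Ventures.GridStability.Models.NE39LosslessLinearisation

/-!
# GridStability/Models/LosslessVariantsAnyDamping — the WSCC9 / NE39 lossless variants of record under an ARBITRARY positive damping profile: every non-synchronous mode is damped; oscillatory modes decay at a weighted-mean rate

Cell `gridfusion` (LADDER-GRIDFUSION, G3-ss / apex line; seat gridfusion-model-3 (g5)). Companion of the
uniform-λ rows #18 «G3-ss-WSCC9-UNIFORM» (p498081) and #23 «G3-ss-NE39L-UNIFORM» (p499544): the SAME
lossless networks and equilibria of record (model-1's `WSCC9.postB_relL`, `NE39L.data`; MODELLED MV-2L synthetic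
+ MV-RD + MV-h12 (+ MV-E6)), now with the damping profile left FREE — `RecastData.toModelD d D a′` carries
ANY assignment `D : Fin (n+1) → ℝ` (the droop reading: ANY positive power-filter constants `τ_Pi = M_i/D_i`,
heterogeneous). By `Models/InverterNetworkDamping.lean` (p502210 / APPEND) no certificate is needed beyond
SIGN CHECKS: both equilibria are ACUTE (`C_ij·(c_ic_j + s_is_j) > 0` for every machine pair, `decide`), so

* `WSCC9.postB_relL_eig_re_neg_anyDamping` / `NE39L.data_eig_re_neg_anyDamping` — for EVERY positive damping
  profile, every complex eigenpair of the Jacobian at the equilibrium of record is synchronous-type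
  (`L(δ*) x = 0`, i.e. the uniform shift — `postB_relL_ker_iff` / `NE39L_ker_iff`) or has `Re z < 0`;
* `…_eig_re_oscillatory_anyDamping` — every OSCILLATORY eigenpair (`Im z ≠ 0`) has
  `−d_max/2 ≤ Re z ≤ −d_min/2` whenever `d_min M_i ≤ D_i ≤ d_max M_i` (uniform `D = λM`: exactly `−λ/2`, the
  #18 / #23 sentence).

What the uniform rows add on top of this file is the RATE for the aperiodic modes and the exact `−λ/2`.
THREE COLUMNS: CERTIFIED = matrix statements; MODELLED as #18 / #23 with «any damping profile» (droop reading
[cite: SchifferEtAl2014, Remark 3.3], [cite: KunduEtAl2019, eqs. (4a)–(4b), (5a)]; classical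
[cite: SauerPai1998, §6.10]); no flow claim; no sentence says a grid or a microgrid is stable.
-/

noncomputable section

open Real Matrix Finset
open scoped ComplexOrder

namespace Summit.Ventures.GridStability.Models

/-! ## §1 A1 data with an arbitrary damping profile -/

namespace RecastData

variable {n : ℕ} (d : RecastData n)

/-- The lossless A1-data model with an ARBITRARY damping assignment `D` (inertias, injections `P′ + M a′`,
voltages and network of the record; `D` free). A family reading, not a new object of record. [folklore] -/
def toModelD (D : Fin (n + 1) → ℝ) (a : ℝ) : ClassicalSwing (n + 1) :=
  { d.toModelRel 0 a with D := D }

/-- Inertias of `toModelD`. [folklore] -/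
theorem toModelD_M (D : Fin (n + 1) → ℝ) (a : ℝ) (i : Fin (n + 1)) : (d.toModelD D a).M i = (d.M i : ℝ) := rfl

/-- Dampings of `toModelD`. [folklore] -/
theorem toModelD_D (D : Fin (n + 1) → ℝ) (a : ℝ) (i : Fin (n + 1)) : (d.toModelD D a).D i = D i := rfl

/-- The synchronising Laplacian does not see the damping: `L(δ)` of `toModelD` is that of `toModelRel`.
[folklore] -/
theorem PeJac_toModelD (D : Fin (n + 1) → ℝ) (a : ℝ) (δ : Fin (n + 1) → ℝ) :
    (d.toModelD D a).PeJac δ = (d.toModelRel 0 a).PeJac δ := rfl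

/-- Lossless data stay lossless. [folklore] -/
theorem isLossless_toModelD (hG : ∀ i j, i ≠ j → d.G i j = 0) (D : Fin (n + 1) → ℝ) (a : ℝ) :
    (d.toModelD D a).IsLossless := fun i j hij => by simp [toModelD, toModelRel, hG i j hij]

/-- Reciprocal data stay reciprocal. [folklore] -/
theorem B_symm_toModelD (hB : ∀ i j, d.B i j = d.B j i) (D : Fin (n + 1) → ℝ) (a : ℝ)
    (i j : Fin (n + 1)) : (d.toModelD D a).B i j = (d.toModelD D a).B j i := by
  simp [toModelD, toModelRel, hB i j]

/-- **Acute A1 data ⇒ nonnegative synchronising coefficients of the real model at `angleOf`:**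
`C_ij cos(θ_i − θ_j) = Cc_ij·cd_ij` (cast of the rational product). [folklore] -/
theorem Ccoef_cos_toModelD (hcirc : ∀ i, d.s i ^ 2 + d.c i ^ 2 = 1) (D : Fin (n + 1) → ℝ) (a : ℝ)
    (i j : Fin (n + 1)) :
    (d.toModelD D a).Ccoef i j * cos (d.angleOf i - d.angleOf j) = ((d.Cc i j * d.cd i j : ℚ) : ℝ) := by
  simp only [ClassicalSwing.Ccoef, toModelD, toModelRel, Cc, cd, cos_sub, d.cos_angleOf (hcirc i),
    d.cos_angleOf (hcirc j), d.sin_angleOf (hcirc i), d.sin_angleOf (hcirc j)]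
  push_cast
  ring

/-- **Any damping profile, acute lossless A1 data: every non-synchronous mode is damped.** `M_i > 0`,
`D_i > 0`, `G` lossless, `B` reciprocal, exact circle points, `Cc_ij·cd_ij ≥ 0` for `i ≠ j`: every complex
eigenpair of the Jacobian of `toModelD D a′` at `angleOf` is synchronous-type or has `Re z < 0`
(`ClassicalSwing.eig_re_neg_of_acute`). CERTIFIED: matrix statement. [folklore] -/
theorem eig_re_neg_anyDamping (hcirc : ∀ i, d.s i ^ 2 + d.c i ^ 2 = 1) (hM : ∀ i, 0 < d.M i)
    (hG : ∀ i j, i ≠ j → d.G i j = 0) (hB : ∀ i j, d.B i j = d.B j i)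
    (hacute : ∀ i j, i ≠ j → 0 ≤ d.Cc i j * d.cd i j) {D : Fin (n + 1) → ℝ} (hD : ∀ i, 0 < D i) (a : ℝ)
    {z : ℂ} {w : Fin (n + 1) ⊕ Fin (n + 1) → ℂ} (hw : w ≠ 0)
    (hJ : ((d.toModelD D a).jacMatrix d.angleOf).map ((↑) : ℝ → ℂ) *ᵥ w = z • w) :
    ((d.toModelD D a).PeJac d.angleOf).map ((↑) : ℝ → ℂ) *ᵥ (w ∘ Sum.inl) = 0 ∨ z.re < 0 :=
  (d.toModelD D a).eig_re_neg_of_acute (fun i => by rw [toModelD_M]; exact_mod_cast hM i)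
    (fun i => hD i) (d.isLossless_toModelD hG D a) (d.B_symm_toModelD hB D a) d.angleOf
    (fun i j hij => by rw [d.Ccoef_cos_toModelD hcirc]; exact_mod_cast hacute i j hij) hw hJ

/-- **Any damping profile: oscillatory modes decay at a weighted-mean damping ratio**
(`ClassicalSwing.eig_re_of_im_ne_zero` on acute lossless A1 data): `Im z ≠ 0` and `d_min M_i ≤ D_i ≤ d_max M_i`
⇒ `−d_max/2 ≤ Re z ≤ −d_min/2`. CERTIFIED: matrix statement. [folklore] -/
theorem eig_re_oscillatory_anyDamping (hcirc : ∀ i, d.s i ^ 2 + d.c i ^ 2 = 1) (hM : ∀ i, 0 < d.M i)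
    (hG : ∀ i j, i ≠ j → d.G i j = 0) (hB : ∀ i j, d.B i j = d.B j i)
    (hacute : ∀ i j, i ≠ j → 0 ≤ d.Cc i j * d.cd i j) {D : Fin (n + 1) → ℝ} {dmin dmax : ℝ}
    (hmin : ∀ i, dmin * (d.M i : ℝ) ≤ D i) (hmax : ∀ i, D i ≤ dmax * (d.M i : ℝ)) (a : ℝ)
    {z : ℂ} {w : Fin (n + 1) ⊕ Fin (n + 1) → ℂ} (hw : w ≠ 0)
    (hJ : ((d.toModelD D a).jacMatrix d.angleOf).map ((↑) : ℝ → ℂ) *ᵥ w = z • w) (hz : z.im ≠ 0) :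
    -(dmax / 2) ≤ z.re ∧ z.re ≤ -(dmin / 2) := by
  have hL : ((d.toModelD D a).PeJac d.angleOf).PosSemidef :=
    (d.toModelD D a).PeJac_posSemidef_of_acute (d.isLossless_toModelD hG D a) (d.B_symm_toModelD hB D a)
      d.angleOf (fun i j hij => by
        rw [(d.toModelD D a).syncCoef_eq_of_lossless (d.isLossless_toModelD hG D a) d.angleOf hij,
          d.Ccoef_cos_toModelD hcirc]
        exact_mod_cast hacute i j hij)
  have h := (d.toModelD D a).eig_re_of_im_ne_zero (fun i => by rw [toModelD_M]; exact_mod_cast hM i)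
    d.angleOf hL (dmin := dmin) (dmax := dmax) (fun i => by rw [toModelD_M, toModelD_D]; exact hmin i)
    (fun i => by rw [toModelD_M, toModelD_D]; exact hmax i) hw hJ hz
  exact h.2

end RecastData

/-! ## §2 WSCC9 lossless variant (the #18 network and equilibrium), any damping profile -/

namespace WSCC9

open RecastData

/-- The block-C equilibrium of the lossless WSCC9 variant is ACUTE: every synchronising coefficient
`C_ij·(c_ic_j + s_is_j)` is positive (`decide`). [folklore] -/
theorem postB_relL_acute : ∀ i j : Fin 3, i ≠ j → 0 < postB_relL.Cc i j * postB_relL.cd i j := by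
  decide +kernel

/-- **#18's network and equilibrium under ANY positive damping profile `D`** (droop reading: any positive
filter constants): every complex eigenpair of the Jacobian is synchronous-type (`L(δ*) x = 0` ⟺ uniform
shift, `postB_relL_ker_iff`) or has `Re z < 0`. CERTIFIED: matrix statement; MODELLED: MV-2L synthetic +
MV-RD + MV-h12, damping free. No stability sentence. [folklore] -/
theorem postB_relL_eig_re_neg_anyDamping {D : Fin 3 → ℝ} (hD : ∀ i, 0 < D i) (a : ℝ) {z : ℂ}
    {w : Fin 3 ⊕ Fin 3 → ℂ} (hw : w ≠ 0)
    (hJ : ((postB_relL.toModelD D a).jacMatrix postB_relL.angleOf).map ((↑) : ℝ → ℂ) *ᵥ w = z • w) :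
    ((postB_relL.toModelD D a).PeJac postB_relL.angleOf).map ((↑) : ℝ → ℂ) *ᵥ (w ∘ Sum.inl) = 0 ∨
      z.re < 0 :=
  postB_relL.eig_re_neg_anyDamping postB_relL_circle.1 (by decide +kernel)
    postB_relL_transferConductance_eq_zero postB_relL_B_symm (fun i j hij => (postB_relL_acute i j hij).le)
    hD a hw hJ

/-- **Oscillatory modes of #18's network under any damping profile with `d_min M_i ≤ D_i ≤ d_max M_i`:
`−d_max/2 ≤ Re z ≤ −d_min/2`.** CERTIFIED: matrix statement; MODELLED as above. [folklore] -/
theorem postB_relL_eig_re_oscillatory_anyDamping {D : Fin 3 → ℝ} {dmin dmax : ℝ}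
    (hmin : ∀ i, dmin * (postB_relL.M i : ℝ) ≤ D i) (hmax : ∀ i, D i ≤ dmax * (postB_relL.M i : ℝ))
    (a : ℝ) {z : ℂ} {w : Fin 3 ⊕ Fin 3 → ℂ} (hw : w ≠ 0)
    (hJ : ((postB_relL.toModelD D a).jacMatrix postB_relL.angleOf).map ((↑) : ℝ → ℂ) *ᵥ w = z • w)
    (hz : z.im ≠ 0) : -(dmax / 2) ≤ z.re ∧ z.re ≤ -(dmin / 2) :=
  postB_relL.eig_re_oscillatory_anyDamping postB_relL_circle.1 (by decide +kernel)
    postB_relL_transferConductance_eq_zero postB_relL_B_symm (fun i j hij => (postB_relL_acute i j hij).le)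
    hmin hmax a hw hJ hz

end WSCC9

/-! ## §3 NE39 lossless variant (the #23 network and equilibrium), any damping profile -/

namespace NE39L

open RecastData

/-- The equilibrium of the NE39L variant is ACUTE (all 90 ordered pairs, `decide`). [folklore] -/
theorem data_acute : ∀ i j : Fin 10, i ≠ j → 0 < data.Cc i j * data.cd i j := by
  decide +kernel

/-- **#23's network and equilibrium under ANY positive damping profile `D`**: every complex eigenpair of the
Jacobian is synchronous-type (uniform shift, `NE39L_ker_iff`) or has `Re z < 0`. CERTIFIED: matrix statement;
MODELLED: MV-2L synthetic + MV-RD + MV-h12 + MV-E6, damping free. No stability sentence. [folklore] -/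
theorem data_eig_re_neg_anyDamping {D : Fin 10 → ℝ} (hD : ∀ i, 0 < D i) (a : ℝ) {z : ℂ}
    {w : Fin 10 ⊕ Fin 10 → ℂ} (hw : w ≠ 0)
    (hJ : ((data.toModelD D a).jacMatrix data.angleOf).map ((↑) : ℝ → ℂ) *ᵥ w = z • w) :
    ((data.toModelD D a).PeJac data.angleOf).map ((↑) : ℝ → ℂ) *ᵥ (w ∘ Sum.inl) = 0 ∨ z.re < 0 :=
  data.eig_re_neg_anyDamping data_circle.1 (by decide +kernel) data_transferConductance_eq_zero data_B_symm
    (fun i j hij => (data_acute i j hij).le) hD a hw hJ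

/-- **Oscillatory modes of #23's network, any damping profile with `d_min M_i ≤ D_i ≤ d_max M_i`:
`−d_max/2 ≤ Re z ≤ −d_min/2`.** CERTIFIED: matrix statement; MODELLED as above. [folklore] -/
theorem data_eig_re_oscillatory_anyDamping {D : Fin 10 → ℝ} {dmin dmax : ℝ}
    (hmin : ∀ i, dmin * (data.M i : ℝ) ≤ D i) (hmax : ∀ i, D i ≤ dmax * (data.M i : ℝ)) (a : ℝ)
    {z : ℂ} {w : Fin 10 ⊕ Fin 10 → ℂ} (hw : w ≠ 0)
    (hJ : ((data.toModelD D a).jacMatrix data.angleOf).map ((↑) : ℝ → ℂ) *ᵥ w = z • w) (hz : z.im ≠ 0) :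
    -(dmax / 2) ≤ z.re ∧ z.re ≤ -(dmin / 2) :=
  data.eig_re_oscillatory_anyDamping data_circle.1 (by decide +kernel) data_transferConductance_eq_zero
    data_B_symm (fun i j hij => (data_acute i j hij).le) hmin hmax a hw hJ hz

end NE39L

end Summit.Ventures.GridStability.Models

end
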